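import Mathlib
import HarnessLib
import Literature.Combinatorics.SimpleGraph.ChordalTreeDecomposition
import Literature.Combinatorics.SimpleGraph.SubtreeHelly

/-!
# Chordal graphs are the intersection graphs of subtrees of a tree (Gavril–Buneman–Walter; Golumbic, Thm. 4.8)

Topic `Literature/Combinatorics/SimpleGraph`.  Twenty-second file of the chordal series.
[Golumbic, *Algorithmic Graph Theory and Perfect Graphs*, Thm. 4.8 (Walter 1972, Gavril 1974,
Buneman 1974)]: for an undirected graph `G` the following are equivalent — (i) `G` is triangulated
(chordal); (ii) `G` is the intersection graph of a family of subtrees of a tree; (iii) there is a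
tree on the maximal cliques of `G` in which, for every vertex `v`, the cliques containing `v` induce
a subtree.  This file proves (i) ⟺ (ii) for finite graphs, through the tree decompositions into
complete parts of `ChordalTreeDecomposition` ([Diestel, Prop. 12.3.8]): a SUBTREE REPRESENTATION
`v ↦ f v ⊆ V(T)` ((ii): each `f v` induces a connected subgraph of the tree `T`, and
`u ∼ v ⟺ u ≠ v ∧ f u ∩ f v ≠ ∅`) is the same thing as a tree decomposition over `T` whose bags
`B_t = {v | t ∈ f v}` are cliques.  The clique-tree form (iii) is `CliqueTree`
(`IsChordal.exists_cliqueTree`, `isChordal_iff_exists_cliqueTree`); the step (ii) ⟹ "every clique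
is seen at one tree vertex" is the Helly property of subtrees (`SubtreeHelly`), recorded here as
`exists_mem_biInter_of_isClique`.

## Contents

* `isChordal_of_subtreeRepresentation` — (ii) ⟹ (i): an intersection graph of finitely indexed
  subtrees of a finite tree is chordal [Golumbic, Thm. 4.8 (ii) ⟹ (i)].
* `IsChordal.exists_subtreeRepresentation` — (i) ⟹ (ii): a chordal graph on a nonempty finite
  vertex set `V` is the intersection graph of subtrees `f v, v ∈ V` of a tree ON `V` itself (the
  elimination tree of a perfect elimination ordering, bags `{v} ∪ adj⁺(v)`)
  [Golumbic, Thm. 4.8 (i) ⟹ (iii) ⟹ (ii)].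
* **`isChordal_iff_exists_subtreeRepresentation`** — [Golumbic, Thm. 4.8 (i) ⟺ (ii)].
* `exists_mem_biInter_of_isClique` — in a subtree representation every nonempty finite clique is
  witnessed at a single tree vertex (Helly) [Golumbic, proof of Thm. 4.8 / Prop. 4.7].

## References

* [Golumbic1980] M. C. Golumbic, *Algorithmic Graph Theory and Perfect Graphs*, Academic Press
  (1980); 2nd ed. (2004) §4.5, Prop. 4.7, Thm. 4.8.  Read: galaxy `panama:327388177104967`,
  chars 244800–248800.
* [Diestel2010] R. Diestel, *Graph Theory*, 4th ed., Prop. 12.3.8 (via `ChordalTreeDecomposition`).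
* F. Gavril, J. Combin. Theory Ser. B 16 (1974) 47–56; P. Buneman, Discrete Math. 9 (1974)
  205–212; J. R. Walter, Ph.D. thesis, Wayne State Univ. (1972) (attribution only).
-/

namespace Literature.Combinatorics.SimpleGraph

open _root_.SimpleGraph

variable {V : Type*} {G : _root_.SimpleGraph V}

/-- **(ii) ⟹ (i): an intersection graph of subtrees of a tree is chordal.**  If `T` is a finite
tree and `f v ⊆ V(T)` induces a connected subgraph for every vertex `v` of the finite graph `G`,
with `u ∼ v ⟺ u ≠ v ∧ f u ∩ f v ≠ ∅`, then `G` is chordal: `t ↦ {v | t ∈ f v}` is a tree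
decomposition of `G` into cliques. [cite: Golumbic1980, Thm. 4.8 ((ii) ⟹ (i))] -/
theorem isChordal_of_subtreeRepresentation [Finite V] {ι : Type*} [Fintype ι]
    {T : _root_.SimpleGraph ι} (hT : T.IsTree) (f : V → Set ι)
    (hconn : ∀ v, (T.induce (f v)).Connected)
    (hadj : ∀ u v, G.Adj u v ↔ u ≠ v ∧ (f u ∩ f v).Nonempty) : IsChordal G := by
  classical
  haveI := Fintype.ofFinite V
  let bag : ι → Finset V := fun t => Finset.univ.filter fun v => t ∈ f v
  have hbag : ∀ t v, v ∈ bag t ↔ t ∈ f v := fun t v => by simp [bag]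
  let D : TreeDecomposition G ι :=
    { tree := T
      isTree := hT
      bag := bag
      exists_mem_bag_of_adj := fun u v huv => by
        obtain ⟨t, htu, htv⟩ := ((hadj u v).1 huv).2
        exact ⟨t, (hbag t u).2 htu, (hbag t v).2 htv⟩
      connected_induce := fun v => by
        have h : {t | v ∈ bag t} = f v := Set.ext fun t => hbag t v
        rw [h]
        exact hconn v }
  refine isChordal_of_treeDecomposition_isClique D fun t => ?_
  intro u hu v hv huv
  exact (hadj u v).2 ⟨huv, t, (hbag t u).1 hu, (hbag t v).1 hv⟩

/-- **(i) ⟹ (ii): a chordal graph is an intersection graph of subtrees of a tree** — indeed of a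
tree on its own (nonempty, finite) vertex set: the elimination tree of a perfect elimination
ordering, vertex `v` represented by `{t | v ∈ B_t}` for the clique bags `B_t = {t} ∪ adj⁺(t)`
(`ChordalTreeDecomposition.IsChordal.exists_treeDecomposition_isClique`).
[cite: Golumbic1980, Thm. 4.8 ((i) ⟹ (ii))] -/
theorem IsChordal.exists_subtreeRepresentation [Fintype V] [Nonempty V] (hG : IsChordal G) :
    ∃ (T : _root_.SimpleGraph V) (f : V → Set V), T.IsTree ∧
      (∀ v, (T.induce (f v)).Connected) ∧ ∀ u v, G.Adj u v ↔ u ≠ v ∧ (f u ∩ f v).Nonempty := by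
  obtain ⟨D, hD⟩ := hG.exists_treeDecomposition_isClique
  refine ⟨D.tree, fun v => {t | v ∈ D.bag t}, D.isTree, D.connected_induce, fun u v => ?_⟩
  constructor
  · intro huv
    obtain ⟨t, hu, hv⟩ := D.exists_mem_bag_of_adj huv
    exact ⟨huv.ne, t, hu, hv⟩
  · rintro ⟨hne, t, hu, hv⟩
    exact hD t hu hv hne

/-- **Chordal ⟺ intersection graph of subtrees of a tree** [Golumbic, Thm. 4.8 (i) ⟺ (ii);
Walter 1972, Gavril 1974, Buneman 1974], for a graph on a nonempty finite vertex set `V`, with the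
representing tree taken on `V` itself. [cite: Golumbic1980, Thm. 4.8 ((i) ⟺ (ii))] -/
theorem isChordal_iff_exists_subtreeRepresentation [Fintype V] [Nonempty V] :
    IsChordal G ↔ ∃ (T : _root_.SimpleGraph V) (f : V → Set V), T.IsTree ∧
      (∀ v, (T.induce (f v)).Connected) ∧ ∀ u v, G.Adj u v ↔ u ≠ v ∧ (f u ∩ f v).Nonempty :=
  ⟨IsChordal.exists_subtreeRepresentation, fun ⟨_, f, hT, hconn, hadj⟩ =>
    isChordal_of_subtreeRepresentation hT f hconn hadj⟩

/-- **In a subtree representation every clique is seen at one tree vertex** (the Helly property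
of subtrees, `IsTree.helly`): if `K` is a nonempty finite clique of the intersection graph of the
subtrees `f v` of a tree, some tree vertex lies in `f v` for every `v ∈ K`.
[cite: Golumbic1980, Thm. 4.8 (proof, via Prop. 4.7)] -/
theorem exists_mem_biInter_of_isClique {ι : Type*} {T : _root_.SimpleGraph ι} (hT : T.IsTree)
    (f : V → Set ι) (hconn : ∀ v, (T.induce (f v)).Connected)
    (hadj : ∀ u v, G.Adj u v ↔ u ≠ v ∧ (f u ∩ f v).Nonempty) {K : Finset V}
    (hK : G.IsClique (K : Set V)) (hKne : K.Nonempty) : (⋂ v ∈ K, f v).Nonempty := by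
  classical
  refine IsAcyclic.helly_finset hT.isAcyclic f K hKne (fun v _ => isConnectedSet_iff.2 (hconn v))
    fun u hu v hv => ?_
  by_cases huv : u = v
  · subst huv
    obtain ⟨⟨t, ht⟩⟩ := (hconn u).nonempty
    exact ⟨t, ht, ht⟩
  · exact ((hadj u v).1 (hK hu hv huv)).2

end Literature.Combinatorics.SimpleGraph
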